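import Summits.KontsevichZagierPeriods.KontsevichZagierPeriods.Theorems.SoloBlindMinCell
import Summits.KontsevichZagierPeriods.KontsevichZagierPeriods.Theorems.SoloBlindTanMoves
import HarnessLib

/-!
# The fence chart: straightening the min cell in every dimension

On the min cell `M_n = {t ∈ T_n | t₀ < tᵢ}` (`SoloBlindMinCell`), in half-angles `αᵢ = arctan tᵢ`,
the conditions are `α₀ < αᵢ`, `α₀ + αᵢ < π/4` and the PATH `αᵢ + αᵢ₊₁ < π/4` (`1 ≤ i ≤ n`).  The
**fence chart** `Y` (`fenceY`) keeps `α₀` and replaces, for `i ≠ 0`,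

  `αᵢ ↦ σᵢ = π/4 − α₀ − αᵢ` (`i` even),   `αᵢ ↦ σᵢ = αᵢ − α₀` (`i` odd),

i.e. `sᵢ = (1 − t₀ − tᵢ − t₀tᵢ)/(1 + t₀ + tᵢ − t₀tᵢ)` resp. `sᵢ = (tᵢ − t₀)/(1 + tᵢt₀)` —
rational over `ℚ`.  In the new coordinates the cell is the **fence cell** `F_n` (`fenceCell`):

  `0 < σ₀ < π/8`,  `0 < σᵢ < π/4 − 2σ₀` (`i ≠ 0`),  `σ₁ < σ₂ > σ₃ < σ₄ > ⋯` (alternating),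

a box over the `σ₀`-fibre cut by order conditions only — every SUM condition is gone, in odd
dimensions too.  This file proves `Y '' M_n = F_n` and the injectivity of `Y` (through the angle
dictionary of `SoloBlindTanMoves`); the Jacobian and the move `[M_n, w] ≡ [F_n, w]` follow in
`SoloBlindFenceMove`.
-/

noncomputable section

open Literature.NumberTheory.Transcendental Literature.NumberTheory.Transcendental.KZ
open Real Set

namespace Summit.KontsevichZagierPeriods.KontsevichZagierPeriods.Theorems

namespace SoloBlind

variable {n : ℕ}

/-! ## `tan(π/4 − α − β)` -/

/-- `cflipT a b = (1 − a − b − ab)/(1 + a + b − ab)` — `tan(π/4 − α − β)`. -/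
def cflipT (a b : ℝ) : ℝ := (1 - a - b - a * b) / (1 + a + b - a * b)

/-- Unfolding `cflipT`. -/
theorem cflipT_eq (a b : ℝ) : cflipT a b = (1 - a - b - a * b) / (1 + a + b - a * b) := rfl

/-- `cflipT a b = φ(addT a b)`. -/
theorem cflipT_eq_flipF_addT {a b : ℝ} (h1 : 1 - a * b ≠ 0) :
    cflipT a b = flipF (addT a b) := by
  have e1 : 1 - (a + b) / (1 - a * b) = (1 - a - b - a * b) / (1 - a * b) := by
    field_simp; ring
  have e2 : 1 + (a + b) / (1 - a * b) = (1 + a + b - a * b) / (1 - a * b) := by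
    field_simp; ring
  rw [cflipT, flipF, addT_eq, e1, e2, div_div_div_cancel_right₀ h1]

/-- The angle of `cflipT`: `arctan (cflipT a b) = π/4 − arctan a − arctan b`
(`a, b ≥ 0`, `ab < 1`). -/
theorem arctan_cflipT {a b : ℝ} (ha : 0 ≤ a) (hb : 0 ≤ b) (hab : a * b < 1) :
    arctan (cflipT a b) = π / 4 - arctan a - arctan b := by
  have h2 : (0 : ℝ) < 1 + a + b - a * b := by linarith
  rw [cflipT_eq_flipF_addT (by linarith),
    arctan_flipF (by linarith [addT_nonneg ha hb hab]), arctan_addT hab]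
  ring

/-! ## The fence chart and the fence cell -/

/-- The fence chart `Y`. -/
def fenceY (t : Fin (n + 2) → ℝ) (i : Fin (n + 2)) : ℝ :=
  if i = 0 then t 0 else if Even i.val then cflipT (t 0) (t i) else subT (t i) (t 0)

/-- The alternating (fence) order conditions `σ₁ < σ₂ > σ₃ < ⋯` on the coordinates `≠ 0`. -/
def IsFence (s : Fin (n + 2) → ℝ) : Prop :=
  ∀ i : Fin (n + 2), i ≠ 0 → i + 1 ≠ 0 →
    (Even i.val → s (i + 1) < s i) ∧ (¬ Even i.val → s i < s (i + 1))

/-- The fence cell `F_n` (polynomial form; see `mem_fenceCell_iff_arctan` for the angles). -/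
def fenceCell (n : ℕ) : Set (Fin (n + 2) → ℝ) :=
  {s | (0 < s 0 ∧ s 0 ^ 2 + 2 * s 0 < 1) ∧
    (∀ i, i ≠ 0 → 0 < s i ∧ s i * (1 - s 0 ^ 2) + 2 * s 0 * (1 + s i) < 1 - s 0 ^ 2) ∧ IsFence s}

/-- Membership in the fence cell. -/
theorem mem_fenceCell {s : Fin (n + 2) → ℝ} : s ∈ fenceCell n ↔ (0 < s 0 ∧ s 0 ^ 2 + 2 * s 0 < 1) ∧
    (∀ i, i ≠ 0 → 0 < s i ∧ s i * (1 - s 0 ^ 2) + 2 * s 0 * (1 + s i) < 1 - s 0 ^ 2) ∧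
    IsFence s := Iff.rfl

/-! ## The angle dictionary -/

/-- `a² + 2a < 1 ↔ 2·arctan a < π/4` (`a > 0`). -/
theorem sq_add_two_mul_lt_one_iff {a : ℝ} (ha : 0 < a) :
    a ^ 2 + 2 * a < 1 ↔ 2 * arctan a < π / 4 := by
  rw [two_mul (arctan a), ← add_add_mul_lt_one_iff ha ha]
  constructor <;> intro h <;> nlinarith

/-- `x(1 − a²) + 2a(1 + x) < 1 − a² ↔ arctan x + 2·arctan a < π/4`
(`x, a > 0`, `2·arctan a < π/4`). -/
theorem fence_ineq_iff {a x : ℝ} (ha : 0 < a) (ha' : a ^ 2 + 2 * a < 1) (hx : 0 < x) :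
    x * (1 - a ^ 2) + 2 * a * (1 + x) < 1 - a ^ 2 ↔ arctan x + 2 * arctan a < π / 4 := by
  have ha1 : a < 1 := by nlinarith
  have hq : 0 < 1 - a ^ 2 := by nlinarith
  have hd : 0 < dblT a := div_pos (by linarith) hq
  rw [← arctan_dblT (by linarith) ha1, ← add_add_mul_lt_one_iff hx hd]
  have key : x + dblT a + x * dblT a =
      (x * (1 - a ^ 2) + 2 * a * (1 + x)) / (1 - a ^ 2) := by
    rw [dblT_eq]; field_simp; ring
  rw [key, div_lt_one hq]

/-- The tangent cell in angles: `αᵢ + αᵢ₊₁ < π/4`. -/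
theorem mem_cycCell_iff_arctan {t : Fin (n + 2) → ℝ} : t ∈ cycCell n ↔
    ∀ i, 0 < t i ∧ arctan (t i) + arctan (t (i + 1)) < π / 4 := by
  rw [mem_cycCell]
  constructor
  · intro h i
    exact ⟨(h i).1, (add_add_mul_lt_one_iff (h i).1 (h (i + 1)).1).mp (h i).2⟩
  · intro h i
    exact ⟨(h i).1, (add_add_mul_lt_one_iff (h i).1 (h (i + 1)).1).mpr (h i).2⟩

/-- The fence cell in angles. -/
theorem mem_fenceCell_iff_arctan {s : Fin (n + 2) → ℝ} : s ∈ fenceCell n ↔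
    (0 < s 0 ∧ 2 * arctan (s 0) < π / 4) ∧
    (∀ i, i ≠ 0 → 0 < s i ∧ arctan (s i) + 2 * arctan (s 0) < π / 4) ∧ IsFence s := by
  rw [mem_fenceCell]
  constructor
  · rintro ⟨⟨h0, h0'⟩, h1, hf⟩
    exact ⟨⟨h0, (sq_add_two_mul_lt_one_iff h0).mp h0'⟩, fun i hi =>
      ⟨(h1 i hi).1, (fence_ineq_iff h0 h0' (h1 i hi).1).mp (h1 i hi).2⟩, hf⟩
  · rintro ⟨⟨h0, h0'⟩, h1, hf⟩
    have h0'' := (sq_add_two_mul_lt_one_iff h0).mpr h0'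
    exact ⟨⟨h0, h0''⟩, fun i hi =>
      ⟨(h1 i hi).1, (fence_ineq_iff h0 h0'' (h1 i hi).1).mpr (h1 i hi).2⟩, hf⟩

/-- Angle facts on the min cell: `αᵢ > 0`, `2α₀ < π/4`, `α₀ + αᵢ < π/4`, `α₀ < αᵢ` (`i ≠ 0`)
and the path conditions. -/
theorem arctan_facts_of_mem_minCell {t : Fin (n + 2) → ℝ} (ht : t ∈ minCell n) :
    (∀ i, 0 < arctan (t i)) ∧ (∀ i, arctan (t 0) + arctan (t i) < π / 4) ∧
      (∀ i, i ≠ 0 → arctan (t 0) < arctan (t i)) ∧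
      ∀ i, arctan (t i) + arctan (t (i + 1)) < π / 4 := by
  refine ⟨fun i => arctan_pos.mpr (ht.1 i).1, fun i => ?_,
    fun i hi => arctan_lt_arctan_iff.mpr (ht.2 i hi), fun i => (mem_cycCell_iff_arctan.mp ht.1 i).2⟩
  exact (add_add_mul_lt_one_iff (ht.1 0).1 (ht.1 i).1).mp (add_lt_one_of_mem_minCell ht i)

/-- The chart in angles: `σ₀ = α₀`, `σᵢ = π/4 − α₀ − αᵢ` (even `i ≠ 0`),
`σᵢ = αᵢ − α₀` (odd `i`). -/
def fenceAng (A : Fin (n + 2) → ℝ) (i : Fin (n + 2)) : ℝ :=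
  if i = 0 then A 0 else if Even i.val then π / 4 - A 0 - A i else A i - A 0

/-- The inverse chart in angles. -/
def fenceAngInv (B : Fin (n + 2) → ℝ) (i : Fin (n + 2)) : ℝ :=
  if i = 0 then B 0 else if Even i.val then π / 4 - B 0 - B i else B i + B 0

/-- `fenceAng ∘ fenceAngInv = id`. -/
theorem fenceAng_fenceAngInv (B : Fin (n + 2) → ℝ) : fenceAng (fenceAngInv B) = B := by
  funext i
  unfold fenceAng fenceAngInv
  by_cases hi : i = 0
  · simp [hi]
  · by_cases he : Even i.val
    · simp only [hi, if_false, he, if_true]; ring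
    · simp only [hi, if_false, he, if_true]; ring

/-- `fenceAngInv ∘ fenceAng = id`. -/
theorem fenceAngInv_fenceAng (A : Fin (n + 2) → ℝ) : fenceAngInv (fenceAng A) = A := by
  funext i
  unfold fenceAng fenceAngInv
  by_cases hi : i = 0
  · simp [hi]
  · by_cases he : Even i.val
    · simp only [hi, if_false, he, if_true]; ring
    · simp only [hi, if_false, he, if_true]; ring

/-- `arctan ∘ Y = fenceAng ∘ arctan` on the min cell. -/
theorem arctan_fenceY {t : Fin (n + 2) → ℝ} (ht : t ∈ minCell n) (i : Fin (n + 2)) :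
    arctan (fenceY t i) = fenceAng (fun j => arctan (t j)) i := by
  unfold fenceY fenceAng
  by_cases hi : i = 0
  · simp [hi]
  · by_cases he : Even i.val
    · simp only [hi, if_false, he, if_true]
      exact arctan_cflipT (ht.1 0).1.le (ht.1 i).1.le (mul_lt_one_of_mem_minCell ht i)
    · simp only [hi, if_false, he]
      exact arctan_subT (by nlinarith [(ht.1 0).1, (ht.1 i).1])

/-- The inverse fence chart. -/
def fenceInv (s : Fin (n + 2) → ℝ) (i : Fin (n + 2)) : ℝ :=
  if i = 0 then s 0 else if Even i.val then subT (flipF (s i)) (s 0) else addT (s i) (s 0)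

/-- Elementary bounds on the fence cell: `0 < sᵢ < 1` for all `i`. -/
theorem bounds_of_mem_fenceCell {s : Fin (n + 2) → ℝ} (hs : s ∈ fenceCell n) (i : Fin (n + 2)) :
    0 < s i ∧ s i < 1 := by
  obtain ⟨⟨h0, h0'⟩, h1, -⟩ := mem_fenceCell_iff_arctan.mp hs
  by_cases hi : i = 0
  · subst hi
    refine ⟨h0, arctan_lt_pi_div_four_iff.mp ?_⟩
    linarith [arctan_pos.mpr h0]
  · refine ⟨(h1 i hi).1, arctan_lt_pi_div_four_iff.mp ?_⟩
    linarith [arctan_pos.mpr h0, (h1 i hi).2]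

/-- `arctan ∘ Y⁻¹ = fenceAngInv ∘ arctan` on the fence cell. -/
theorem arctan_fenceInv {s : Fin (n + 2) → ℝ} (hs : s ∈ fenceCell n) (i : Fin (n + 2)) :
    arctan (fenceInv s i) = fenceAngInv (fun j => arctan (s j)) i := by
  have hb := bounds_of_mem_fenceCell hs
  unfold fenceInv fenceAngInv
  by_cases hi : i = 0
  · simp [hi]
  · by_cases he : Even i.val
    · simp only [hi, if_false, he, if_true]
      have hf : 0 < flipF (s i) := flipF_pos (hb i).1.le (hb i).2
      rw [arctan_subT (by nlinarith [(hb 0).1]), arctan_flipF (by linarith [(hb i).1])]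
      ring
    · simp only [hi, if_false, he]
      exact arctan_addT (by nlinarith [(hb i).1, (hb i).2, (hb 0).1, (hb 0).2])

/-! ## `Y` maps the min cell onto the fence cell -/

/-- No wrap-around: for `i + 1 ≠ 0`, `(i + 1).val = i.val + 1`. -/
theorem val_add_one_of_ne {i : Fin (n + 2)} (h : i + 1 ≠ 0) : (i + 1).val = i.val + 1 := by
  rcases lt_or_eq_of_le (Fin.le_last i) with h' | h'
  · exact Fin.val_add_one_of_lt h'
  · exact absurd (by rw [h', Fin.last_add_one]) h

/-- `Y(M_n) ⊆ F_n`. -/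
theorem fenceY_mem_fenceCell {t : Fin (n + 2) → ℝ} (ht : t ∈ minCell n) :
    fenceY t ∈ fenceCell n := by
  obtain ⟨hpos, hsum, hmin, hpath⟩ := arctan_facts_of_mem_minCell ht
  have hY := arctan_fenceY ht
  have hpos' : ∀ i, 0 < fenceY t i := fun i => by
    rw [← arctan_pos, hY]
    unfold fenceAng
    by_cases hi : i = 0
    · simp only [hi, if_true]; exact hpos 0
    · by_cases he : Even i.val
      · simp only [hi, if_false, he, if_true]; linarith [hsum i]
      · simp only [hi, if_false, he]; linarith [hmin i hi]
  rw [mem_fenceCell_iff_arctan]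
  refine ⟨⟨hpos' 0, ?_⟩, fun i hi => ⟨hpos' i, ?_⟩, fun i hi hi1 => ?_⟩
  · rw [hY]; simp only [fenceAng, if_true]; linarith [hsum 0]
  · rw [hY i, hY 0]
    unfold fenceAng
    by_cases he : Even i.val
    · simp only [hi, if_false, he, if_true]; linarith [hmin i hi]
    · simp only [hi, if_false, he, if_true]; linarith [hsum i]
  · have hv := val_add_one_of_ne hi1
    constructor
    · intro he
      have ho : ¬ Even (i + 1).val := by rw [hv, Nat.even_add_one]; exact not_not.mpr he
      rw [← arctan_lt_arctan_iff, hY, hY]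
      unfold fenceAng
      simp only [hi1, if_false, ho, hi, he, if_true]
      linarith [hpath i]
    · intro ho
      have he : Even (i + 1).val := by rw [hv, Nat.even_add_one]; exact ho
      rw [← arctan_lt_arctan_iff, hY, hY]
      unfold fenceAng
      simp only [hi, if_false, ho, hi1, he, if_true]
      linarith [hpath i]

/-- `Y⁻¹(F_n) ⊆ M_n`. -/
theorem fenceInv_mem_minCell {s : Fin (n + 2) → ℝ} (hs : s ∈ fenceCell n) :
    fenceInv s ∈ minCell n := by
  obtain ⟨⟨h0, h0'⟩, h1, hf⟩ := mem_fenceCell_iff_arctan.mp hs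
  have hB : ∀ i, 0 < arctan (s i) := fun i => arctan_pos.mpr (bounds_of_mem_fenceCell hs i).1
  have hI := arctan_fenceInv hs
  -- the new angles `αᵢ = arctan (Y⁻¹ s)ᵢ`
  have hA0 : ∀ i, i ≠ 0 → arctan (fenceInv s 0) < arctan (fenceInv s i) ∧
      arctan (fenceInv s 0) + arctan (fenceInv s i) < π / 4 := by
    intro i hi
    rw [hI, hI]
    unfold fenceAngInv
    by_cases he : Even i.val
    · simp only [hi, if_false, he, if_true]
      constructor <;> linarith [(h1 i hi).2, hB i]
    · simp only [hi, if_false, he, if_true]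
      constructor <;> linarith [(h1 i hi).2, hB i]
  have hApos : ∀ i, 0 < arctan (fenceInv s i) := by
    intro i
    by_cases hi : i = 0
    · rw [hi, hI]; simp only [fenceAngInv, if_true]; exact hB 0
    · have := (hA0 i hi).1
      rw [hI 0] at this
      simp only [fenceAngInv, if_true] at this
      linarith [hB 0]
  refine ⟨mem_cycCell_iff_arctan.mpr fun i => ⟨arctan_pos.mp (hApos i), ?_⟩,
    fun i hi => arctan_lt_arctan_iff.mp (hA0 i hi).1⟩
  by_cases hi : i = 0
  · rw [hi, zero_add]; exact (hA0 1 one_ne_zero).2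
  by_cases hi1 : i + 1 = 0
  · rw [hi1]; rw [add_comm]; exact (hA0 i hi).2
  have hv := val_add_one_of_ne hi1
  rw [hI, hI]
  unfold fenceAngInv
  by_cases he : Even i.val
  · have ho : ¬ Even (i + 1).val := by rw [hv, Nat.even_add_one]; exact not_not.mpr he
    simp only [hi, if_false, he, if_true, hi1, ho]
    linarith [arctan_lt_arctan_iff.mpr ((hf i hi hi1).1 he)]
  · have he' : Even (i + 1).val := by rw [hv, Nat.even_add_one]; exact he
    simp only [hi, if_false, he, hi1, he', if_true]
    linarith [arctan_lt_arctan_iff.mpr ((hf i hi hi1).2 he)]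

/-- `Y ∘ Y⁻¹ = id` on the fence cell. -/
theorem fenceY_fenceInv {s : Fin (n + 2) → ℝ} (hs : s ∈ fenceCell n) : fenceY (fenceInv s) = s := by
  funext i
  apply arctan_injective
  rw [arctan_fenceY (fenceInv_mem_minCell hs)]
  have h : (fun j => arctan (fenceInv s j)) = fenceAngInv fun j => arctan (s j) :=
    funext (arctan_fenceInv hs)
  rw [h, fenceAng_fenceAngInv]

/-- `Y⁻¹ ∘ Y = id` on the min cell. -/
theorem fenceInv_fenceY {t : Fin (n + 2) → ℝ} (ht : t ∈ minCell n) : fenceInv (fenceY t) = t := by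
  funext i
  apply arctan_injective
  rw [arctan_fenceInv (fenceY_mem_fenceCell ht)]
  have h : (fun j => arctan (fenceY t j)) = fenceAng fun j => arctan (t j) :=
    funext (arctan_fenceY ht)
  rw [h, fenceAngInv_fenceAng]

/-- `Y` is injective on the min cell. -/
theorem injOn_fenceY : InjOn fenceY (minCell n) := fun t ht t' ht' h => by
  rw [← fenceInv_fenceY ht, ← fenceInv_fenceY ht', h]

/-- **`Y '' M_n = F_n`.** -/
theorem image_fenceY : fenceY '' minCell n = fenceCell n := by
  refine Subset.antisymm (image_subset_iff.mpr fun t ht => fenceY_mem_fenceCell ht) fun s hs => ?_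
  exact ⟨fenceInv s, fenceInv_mem_minCell hs, fenceY_fenceInv hs⟩

end SoloBlind

end Summit.KontsevichZagierPeriods.KontsevichZagierPeriods.Theorems
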